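import Mathlib.NumberTheory.ArithmeticFunction.Moebius
import Mathlib.Data.Nat.Factorization.Basic
import Literature.NumberTheory.LFunctions.LOneLowerBoundParityHalves
import Literature.NumberTheory.LFunctions.ConreyIwaniec2002SpacingMechanism
import HarnessLib

/-!
# Route `PrimeLevelFamEdge` — TYPED IDEA DELTAS, deck 16: the EVEN-TWIN near-miss INSIDE Conrey–Iwaniec 2002
# (card K-L23-1, cell ls-idea, seat `ls-idea-lens-23`, lens `nearmiss` × CI-GAPS-INTERNAL; critic F b2 PASS as
# located-residual → even-half crux; LANDING NOTE typer ls-idea-typ-1 gen 2: the seat's `Sketch_L23_EvenTwin_v1_1.lean`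
# VERBATIM up to (i) namespace `LsIdea.L23` → the deck namespace `.EvenTwin`, (ii) every 0-ary shape made
# PARAMETRIC — `CITheorem12Even A` / `…EvenSq A` / `…EvenTwoAdic A` in the log-exponent `A` (the card's `A = 90`),
# `CIProp64Even c₀` in the threshold exponent, `CICor63EvenWith C` in the constant, the two ports in `(c₀, A)` —
# so `lOneLowerBoundEven_of_ciGapsEven` holds at every exponent `A`; the compositions with the printed ODD fact
# stay at `A = 90`.)

HONESTY. No exceptional-zero theorem, no case of Theorem 1/2 of arXiv:2211.02515, no instance of
(1.22) and no even-character theorem is proved here or by ideation; typed ≠ proved; computed ≠ proved;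
located ≠ endorsed. Everything below is either a DEFINITION (a `Prop`, never asserted) or PROVED
bookkeeping (implications between named `Prop`s). The named fact `conreyIwaniec2002_theorem12`
(Acta Arith. 103 (2002) Thm 1.2, ODD real characters) is used only as a hypothesis.

THE MEASURED DEFICIT (CI-GAPS-INTERNAL). The door of record
`ciGaps_door_exists : conreyIwaniec2002_theorem12 → (∃ c > 0, SubnormalGapsHypothesis c) → (odd χ, q > 4:
‖L(1,χ)‖ ≥ c′(log q)^{-90})` lands on `LOneLowerBoundOdd 90` only (`lOneLowerBoundOdd_of_ciGaps`), while the
leaf is `LOneLowerBound A ↔ LOneLowerBoundOdd A ∧ LOneLowerBoundEven A` (`lOneLowerBound_iff_odd_and_even`).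
Audit of the printed proof (arXiv:math/0111012 = [ConreyIwaniec2002]): the chain
Thm 1.2 = Cor 10.2 ⇐ Prop 10.1 ⇐ (9.12) ⇐ Props 8.1/9.1 ⇐ {Prop 6.4, Cor 6.3, Prop 7.1–Lemma 7.5} ⇐
Thm 6.1/Cor 6.2 (AXIOMATIC in λ: hypotheses (6.15)–(6.24)) ⇐ Thm 4.4 (⇐ Thm 4.1 ⇐ Props 3.1–3.3 ⇐ Prop 2.1)
is PARITY-BOUND at exactly ONE load-bearing station: hypothesis (6.19) (the shifted-convolution asymptotic
for λ(n) = τ(n;χ_v,χ_w)) is verified by Theorem 4.4 ONLY for «q squarefree, q ≡ −1 (mod 4)» (weight-1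
HOLOMORPHIC Eisenstein series, ω-stroke Voronoi with kernel J₀, §2 standing assumption k ≥ 1,
χ(−1) = (−1)^k). Everything downstream of (6.19)–(6.24) is parity-blind (real K = ℚ(√q): ζ_K = ζ·L(χ),
Λ_K(s) = (√q/π)^s Γ(s/2)² ζ_K(s), |X(½+it)| = 1, Stirling), and the main-term SHAPE σ(h) (4.32) is a
parity-free formula (numerically confirmed for even q = 5, 13, 17 to 10⁻³, folder compute/).
TOLERANCE (measured from (6.28)–(6.41)): with error τ(h)·q^b·X^{1−δ} in (6.19) the choice
H = B^{-1/2}T^{-1}Y^{1+δ/2} gives the Cor 6.2 error B^{1/2}T^{-1}Y^{2−δ/2}; at Y = qT Prop 6.4 holds for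
T ≥ q^{c(b,δ)}, c(b,δ) = (b+6)/δ (printed: b = 6, δ = ¼, threshold q^{65} via Y ≤ T^{31/30}); Cor 10.2 works at
log T = (log q)^{20} ≥ c(b,δ)·log q for q ≥ exp(c^{1/19}) — so ANY b < ∞, ANY δ > 0 closes the even half with the
SAME exponent 90. SINGLE INPUT = `CIShiftedDivisor true b δ` for some (b, δ) (the q-uniform, power-saving
binary additive divisor asymptotic for a(n) = #{ideals of norm n in ℚ(√q)}, q ≡ 1 (4) squarefree) — in print
STRUCTURALLY for both signs of D (Motohashi, Cardiff 1995 vol. [corpus: book:greaves1997 pp. 309–321],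
q-uniformity «to be studied elsewhere», p. 310) and QUANTITATIVELY for the odd sign only ([ConreyIwaniec2002]
Thm 4.4: b = 6, δ = ¼).

## References
* [ConreyIwaniec2002] J. B. Conrey, H. Iwaniec, Acta Arith. 103 (2002) 259–312 = arXiv:math/0111012:
  Thm 1.2, Prop 2.1, Props 3.1–3.3, Thms 4.1/4.3/4.4, (4.23), (4.26)–(4.36), Thm 6.1 (6.15)–(6.26),
  Cor 6.2/6.3, Prop 6.4 (6.52), Prop 7.1–Lemma 7.5, Props 8.1/9.1/10.1, Cor 10.2. [held]
* [Motohashi1997Dedekind] Y. Motohashi, *The mean square of Dedekind zeta-functions of quadratic number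
  fields*, in: Sieve Methods, Exponential Sums, and their Applications in Number Theory (Cardiff 1995),
  LMS LN 237, CUP 1997, 309–324, doi:10.1017/cbo9780511526091: Thm 1 (3.2) both signs of D, (1.1) q
  squarefree, (3.4), p. 310 l. 1–6, p. 320. [held: book:greaves1997…]
* [DFI1994Quadratic] W. Duke, J. Friedlander, H. Iwaniec, *A quadratic divisor problem*, Invent. Math.
  115 (1994) 209–217 (level 1, d(n), kernels K₀/Y₀, error x^{3/4}). [held: paper:galaxy-pdf-1917844005165312740]
* [Zhang2022LandauSiegel] Y. Zhang, arXiv:2211.02515v1, §1 Theorem 1 (shape). [held]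
-/

noncomputable section

open Complex MeasureTheory

namespace Summit.Parity.GeneralizedHardyLittlewood.Theorems.PrimeLevelFamEdgeIdeaDeltas.EvenTwin

open Literature.NumberTheory.LFunctions Literature.NumberTheory.LFunctions.ConreyIwaniec2002

/-! ### 1. The even twin of the named fact (shape only — NOT a literature fact: nobody printed it) -/

/-- **`CITheorem12Even`** — Theorem 1.2 of [ConreyIwaniec2002] with `χ.Odd` replaced by `χ.Even`
(real quadratic `K = ℚ(√q)`), same exponent `90`: for every `c > 0` there is an effective `c′ > 0`
with `SubnormalGapsHypothesis c → ‖L(1,χ)‖ ≥ c′(log q)^{−A}` for every EVEN real primitive `χ` mod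
`q > 4` (PARAMETRIC in the exponent `A`; the card's twin is `A = 90`). The «C3 = EVEN-CHARACTER TWIN» of the
desk's packet v4 §4. A PREDICATE; never asserted; not in print. [cite: ConreyIwaniec2002, Theorem 1.2 (shape, parity swapped)] -/
def CITheorem12Even (A : ℕ) : Prop :=
  ∀ c : ℝ, 0 < c → ∃ c' : ℝ, 0 < c' ∧
    (SubnormalGapsHypothesis c →
      ∀ (q : ℕ) [NeZero q], 4 < q → ∀ χ : DirichletCharacter ℂ q,
        χ.IsPrimitive → χ.IsQuadratic → χ.Even →
          c' * Real.log q ^ (-(A : ℝ)) ≤ ‖χ.LFunction 1‖)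

/-! ### 2. The single input, at three depths (all `Prop`s, never asserted) -/

/-- **Test-function class (4.23)**: `g` of class `𝒞²`, supported in `[X, 2X]`, with
`x^ν |g^{(ν)}(x)| ≤ 1` for `ν = 0,1,2`. [cite: ConreyIwaniec2002, (4.23)] -/
def IsCITest (g : ℝ → ℝ) (X : ℝ) : Prop :=
  ContDiff ℝ 2 g ∧ Function.support g ⊆ Set.Icc X (2 * X) ∧
    ∀ ν : ℕ, ν ≤ 2 → ∀ x : ℝ, 0 < x → x ^ ν * |iteratedDeriv ν g x| ≤ 1

/-- **CI's main-term density `σ(h)` (4.32) at the cusp pair `(v,w) = (1,q)`** (the case `λ = τ(·,χ)`,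
`ψ = 1`, the only one Theorem 1.2 uses), as a PARITY-FREE formula in `q`, `h` and `L(1,χ)²`:
`σ(h) = {1 + μ(q/(h,q))·((h,q)/q)·∏_{p ∣ (h,q)} (1 − p^{−α} − p^{−α−1})}·(ζ_q(2)/ζ(2))·(∑_{d ∣ h, (d,q)=1} d^{−1})·L(1,χ)²`,
`p^α ∥ h`, `ζ_q(2) = ∏_{p ∣ q}(1 − p^{−2})^{−1}`, `ζ(2) = π²/6`. [cite: ConreyIwaniec2002, (4.27)–(4.32)] -/
def ciSigma (q : ℕ) (LOneSq : ℝ) (h : ℕ) : ℝ :=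
  (1 + (ArithmeticFunction.moebius (q / Nat.gcd h q) : ℝ) * ((Nat.gcd h q : ℝ) / q) *
      ∏ p ∈ (Nat.gcd h q).primeFactors,
        (1 - (p : ℝ) ^ (-(h.factorization p : ℝ)) - (p : ℝ) ^ (-((h.factorization p : ℝ) + 1)))) *
    ((∏ p ∈ q.primeFactors, (1 - ((p : ℝ) ^ 2)⁻¹)⁻¹) / (Real.pi ^ 2 / 6)) *
    (∑ d ∈ h.divisors.filter (fun d ↦ Nat.Coprime d q), (d : ℝ)⁻¹) * LOneSq

/-- **`CIShiftedDivisor even b δ` — hypothesis (6.19) = (4.26) for `λ = τ(·,χ)`, `χ` the real primitive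
character mod `q` squarefree, `q > 4`, of parity `even`, with TOLERANCE `(b, δ)`**: for all `h ≥ 1`,
`X ≥ ½`, test functions `g₁, g₂` of class (4.23) on `[X,2X]`,
`Σ_{m−n=h} τ(m,χ)τ(n,χ)g₁(m)g₂(n) = σ(h)∫g₁(x+h)g₂(x)dx + O(τ(h)·q^b·X^{1−δ}(log 3X)²)` with ONE absolute
constant and `σ(h) = ciSigma q L(1,χ)² h`. `even = false, b = 6, δ = ¼` is the printed Theorem 4.4 (case
`(v,w) = (1,q)`, `q ≡ −1 (4)`); `even = true` (any `b`, `δ > 0`) is the UNPRINTED even twin — the single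
input of K-L23-1. A PREDICATE; never asserted. [cite: ConreyIwaniec2002, Theorem 4.4 (4.26), (6.19)] -/
def CIShiftedDivisor (even : Bool) (b δ : ℝ) : Prop :=
  ∃ C₀ : ℝ, 0 < C₀ ∧
    ∀ (q : ℕ) [NeZero q], 4 < q → Squarefree q → ∀ χ : DirichletCharacter ℂ q,
      χ.IsPrimitive → χ.IsQuadratic → (if even then χ.Even else χ.Odd) →
        ∀ h : ℕ, 1 ≤ h → ∀ X : ℝ, 1 / 2 ≤ X → ∀ g₁ g₂ : ℝ → ℝ, IsCITest g₁ X → IsCITest g₂ X →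
          ‖(∑ n ∈ Finset.Icc 1 ⌊2 * X⌋₊,
                divisorSumChar χ (n + h) * divisorSumChar χ n * (g₁ (n + h) : ℂ) * (g₂ n : ℂ)) -
              ((ciSigma q (‖χ.LFunction 1‖ ^ 2) h * ∫ x in Set.Ioi (0 : ℝ), g₁ (x + h) * g₂ x : ℝ) : ℂ)‖ ≤
            C₀ * (h.divisors.card : ℝ) * (q : ℝ) ^ b * X ^ (1 - δ) * Real.log (3 * X) ^ 2

/-- **`CICor63EvenWith C`** — Corollary 6.3 (6.49) for EVEN real primitive `χ`: `Σ_{X ≤ n ≤ Y} τ(n,χ)²/n ≪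
ℒ(Y) log(Y/X) + (q/X)^{1/2}` (the printed proof — Rankin–Selberg (6.43)–(6.48) — is parity-free; the tree's
`conreyIwaniec2002_corollary63` is typed with `χ.Odd` as printed in context); PARAMETRIC in the implied
constant `C` (the seat's 0-ary shape is `∃ C, CICor63EvenWith C`). A PREDICATE; never asserted.
[cite: ConreyIwaniec2002, Corollary 6.3 (6.49)–(6.50)] -/
def CICor63EvenWith (C : ℝ) : Prop :=
  0 < C ∧
    ∀ (q : ℕ) [NeZero q], 4 < q → ∀ χ : DirichletCharacter ℂ q,
      χ.IsPrimitive → χ.IsQuadratic → χ.Even →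
        ∀ X Y : ℝ, 1 ≤ X → 2 * X ≤ Y →
          ∑ n ∈ Finset.Icc ⌈X⌉₊ ⌊Y⌋₊, ‖divisorSumChar χ n‖ ^ 2 / (n : ℝ) ≤
            C * (calL χ Y * Real.log (Y / X) + Real.sqrt (q / X))

/-- **`CIProp64Even`** — Proposition 6.4 (6.52) for `λ = τ(·,χ)` (`ψ = 1`), `χ` EVEN real primitive mod
`q > 4` squarefree, with the threshold exponent `c₀` as PARAMETER (printed odd case: `c₀ = 65`):
`∫_T^{2T} |Σ_n a(n)τ(n,χ)n^{−1/2−it}|² dt ≤ C·T·ℒ(T)·log q` for `T ≥ q^{c₀}`, `a ∈ IsCutoff a T (qT)`.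
The form in which §§8–10 consume the input. A PREDICATE; never asserted.
[cite: ConreyIwaniec2002, Proposition 6.4 (6.52) (shape, parity swapped, threshold freed)] -/
def CIProp64Even (c₀ : ℕ) : Prop :=
  ∃ C : ℝ, 0 < C ∧
    ∀ (q : ℕ) [NeZero q], 4 < q → Squarefree q → ∀ χ : DirichletCharacter ℂ q,
      χ.IsPrimitive → χ.IsQuadratic → χ.Even →
        ∀ (T : ℝ) (a : ℝ → ℂ), (q : ℝ) ^ c₀ ≤ T → IsCutoff a T (q * T) →
          ∫ t in T..2 * T,
              ‖LSeries (fun n ↦ a n * divisorSumChar χ n) (1 / 2 + t * I)‖ ^ 2 ≤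
            C * (T * calL χ T * Real.log q)

/-! ### 3. The two ports (printed proofs read verbatim with parity swapped; support-grade, never asserted) -/

/-- **§6 port**: Theorem 6.1 → Corollary 6.2 → Proposition 6.4 with the even (6.19) as input: SOME
tolerance `(b, δ)`, `δ > 0`, suffices (threshold exponent `c₀ = ⌈(b+6)/δ⌉`; PARAMETRIC in `c₀`).
[cite: ConreyIwaniec2002, (6.27)–(6.41), Proposition 6.4] -/
def CISixPortEven (c₀ : ℕ) : Prop :=
  (∃ b δ : ℝ, 0 < δ ∧ CIShiftedDivisor true b δ) → (∃ C : ℝ, CICor63EvenWith C) → CIProp64Even c₀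

/-- **§§7–10 port**: Prop 7.1–Lemma 7.5 (gamma factor `Γ(s/2)²` instead of `Γ(s)`; `|X(½+it)| = 1`),
Props 8.1/9.1, (9.12), Prop 10.1, Cor 10.2 with `A = 14`, `log T = (log q)^{20}`; the 2-adic conductors
`q ∈ {4m, 8m}` «without compromising our applications» as in §2 (PARAMETRIC in the threshold `c₀` and the
output exponent `A`; the card's port is `A = 90`). [cite: ConreyIwaniec2002, §§7–10, Corollary 10.2] -/
def CISevenTenPortEven (c₀ A : ℕ) : Prop :=
  CIProp64Even c₀ → (∃ C : ℝ, CICor63EvenWith C) → CITheorem12Even A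

/-! ### 4. PROVED glue: what the twin buys (the leaf at exponent 90 from ONE ζ-hypothesis) -/

/-- At ONE modulus the values `‖L(1,χ)‖`, `χ ≠ 1`, have a uniform positive lower bound. [folklore] -/
private theorem exists_lOne_lower_at (D : ℕ) [NeZero D] :
    ∃ m : ℝ, 0 < m ∧ ∀ χ : DirichletCharacter ℂ D, χ ≠ 1 → m ≤ ‖χ.LFunction 1‖ := by
  classical
  haveI : Finite (DirichletCharacter ℂ D) := MulChar.finite
  let f : DirichletCharacter ℂ D → ℝ := fun χ ↦ if χ = 1 then 1 else ‖χ.LFunction 1‖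
  have hfpos : ∀ χ, 0 < f χ := by
    intro χ
    by_cases hχ : χ = 1
    · simp [f, hχ]
    · simp only [f, hχ, if_false]
      exact norm_pos_iff.mpr (DirichletCharacter.LFunction_apply_one_ne_zero hχ)
  obtain ⟨χ₀, hχ₀⟩ := Finite.exists_min f
  refine ⟨f χ₀, hfpos χ₀, fun χ hχ ↦ ?_⟩
  have := hχ₀ χ
  simp only [f, hχ, if_false] at this
  exact this

/-- Uniform positive lower bound for `‖L(1,χ)‖` over nontrivial characters of modulus `D ≤ 4`. [folklore] -/
private theorem exists_lOne_lower_le_four :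
    ∃ m : ℝ, 0 < m ∧ ∀ (D : ℕ) [NeZero D] (χ : DirichletCharacter ℂ D), D ≤ 4 → χ ≠ 1 →
      m ≤ ‖χ.LFunction 1‖ := by
  obtain ⟨m₁, hm₁, h₁⟩ := exists_lOne_lower_at 1
  obtain ⟨m₂, hm₂, h₂⟩ := exists_lOne_lower_at 2
  obtain ⟨m₃, hm₃, h₃⟩ := exists_lOne_lower_at 3
  obtain ⟨m₄, hm₄, h₄⟩ := exists_lOne_lower_at 4
  refine ⟨min (min m₁ m₂) (min m₃ m₄), by positivity, fun D _ χ hD hχ ↦ ?_⟩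
  have hD0 : D ≠ 0 := NeZero.ne D
  interval_cases D
  · exact absurd rfl hD0
  · exact (h₁ χ hχ).trans' ((min_le_left _ _).trans (min_le_left _ _))
  · exact (h₂ χ hχ).trans' ((min_le_left _ _).trans (min_le_right _ _))
  · exact (h₃ χ hχ).trans' ((min_le_right _ _).trans (min_le_left _ _))
  · exact (h₄ χ hχ).trans' ((min_le_right _ _).trans (min_le_right _ _))

/-- **The even door, uniform form** (proved from the twin's shape): ONE effective constant for all even
real primitive characters of conductor `> 4`. [cite: ConreyIwaniec2002, Theorem 1.2 (shape, parity swapped)] -/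
theorem ciGapsEven_door_exists {A : ℕ} (hE : CITheorem12Even A)
    (hX : ∃ c : ℝ, 0 < c ∧ SubnormalGapsHypothesis c) :
    ∃ c' : ℝ, 0 < c' ∧ ∀ (q : ℕ) [NeZero q], 4 < q → ∀ χ : DirichletCharacter ℂ q,
      χ.IsPrimitive → χ.IsQuadratic → χ.Even →
        c' * Real.log q ^ (-(A : ℝ)) ≤ ‖χ.LFunction 1‖ := by
  obtain ⟨c, hc, hXc⟩ := hX
  obtain ⟨c', hc', h⟩ := hE c hc
  exact ⟨c', hc', h hXc⟩

/-- **The twin closes the EVEN half of the leaf at its exponent `A`** (proved modulo the twin's shape):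
`CITheorem12Even A → (∃ c > 0, SubnormalGapsHypothesis c) → LOneLowerBoundEven A`; conductors `D ≤ 4` are
absorbed into the constant by `L(1,χ) ≠ 0` and finiteness. Mirror of `lOneLowerBoundOdd_of_ciGaps`.
[cite: ConreyIwaniec2002, Theorem 1.2 (shape, parity swapped)] [cite: Zhang2022LandauSiegel, §1 Theorem 1 (shape)] -/
theorem lOneLowerBoundEven_of_ciGapsEven {A : ℕ} (hE : CITheorem12Even A)
    (hX : ∃ c : ℝ, 0 < c ∧ SubnormalGapsHypothesis c) : LOneLowerBoundEven A := by
  obtain ⟨c', hc', h⟩ := ciGapsEven_door_exists hE hX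
  obtain ⟨m, hm, hsmall⟩ := exists_lOne_lower_le_four
  refine ⟨min (c' / 2) (m / 2), by positivity, fun D _ χ hD hq hp he ↦ ?_⟩
  have h3 : (3 : ℝ) ≤ D := by exact_mod_cast hD
  have hlog1 : 1 ≤ Real.log (D : ℝ) := by
    rw [← Real.log_exp 1]
    exact Real.log_le_log (Real.exp_pos 1) (by linarith [Real.exp_one_lt_d9])
  have hpow1 : 1 ≤ Real.log (D : ℝ) ^ A := one_le_pow₀ hlog1
  have hpow : 0 < Real.log (D : ℝ) ^ A := by positivity
  by_cases h4 : 4 < D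
  · have hci := h D h4 χ hp hq he
    have hrpow : Real.log (D : ℝ) ^ (-(A : ℝ)) = (Real.log (D : ℝ) ^ A)⁻¹ := by
      rw [Real.rpow_neg (by linarith), Real.rpow_natCast]
    rw [hrpow, ← div_eq_mul_inv] at hci
    calc min (c' / 2) (m / 2) / Real.log D ^ A ≤ (c' / 2) / Real.log D ^ A :=
          div_le_div_of_nonneg_right (min_le_left _ _) hpow.le
      _ < c' / Real.log D ^ A := by
          apply div_lt_div_of_pos_right _ hpow
          linarith
      _ ≤ ‖χ.LFunction 1‖ := hci
  · push Not at h4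
    have hχ1 : χ ≠ 1 := by
      rintro rfl
      have hc : DirichletCharacter.conductor (1 : DirichletCharacter ℂ D) = D := hp
      rw [DirichletCharacter.conductor_one] at hc
      omega
    have hmle := hsmall D χ h4 hχ1
    calc min (c' / 2) (m / 2) / Real.log D ^ A ≤ min (c' / 2) (m / 2) :=
          div_le_self (by positivity) hpow1
      _ ≤ m / 2 := min_le_right _ _
      _ < m := by linarith
      _ ≤ ‖χ.LFunction 1‖ := hmle

/-- **Both twins close the FULL leaf shape at exponent 90 from ONE ζ-hypothesis** (proved modulo the
named fact and the twin's shape): `conreyIwaniec2002_theorem12 → CITheorem12Even →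
(∃ c > 0, SubnormalGapsHypothesis c) → LOneLowerBound 90`. [cite: ConreyIwaniec2002, Theorem 1.2]
[cite: Zhang2022LandauSiegel, §1 Theorem 1 (shape)] -/
theorem lOneLowerBound90_of_ciGaps_twins (hCI : conreyIwaniec2002_theorem12) (hE : CITheorem12Even 90)
    (hX : ∃ c : ℝ, 0 < c ∧ SubnormalGapsHypothesis c) :
    Zhang2022.Skeleton.LOneLowerBound 90 :=
  lOneLowerBound_of_odd_of_even (lOneLowerBoundOdd_of_ciGaps hCI hX) (lOneLowerBoundEven_of_ciGapsEven hE hX)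

/-- **… hence the leaf `Theorem1 = LOneLowerBound 2022`** (slack `2022 − 90 = 1932` unused).
[cite: Zhang2022LandauSiegel, §1 Theorem 1 (shape)] [cite: ConreyIwaniec2002, Theorem 1.2] -/
theorem theorem1_of_ciGaps_twins (hCI : conreyIwaniec2002_theorem12) (hE : CITheorem12Even 90)
    (hX : ∃ c : ℝ, 0 < c ∧ SubnormalGapsHypothesis c) :
    Zhang2022.Skeleton.Theorem1 :=
  lOneLowerBound_of_odd_of_even
    (LOneLowerBoundOdd.mono (by norm_num) (lOneLowerBoundOdd_of_ciGaps hCI hX))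
    (LOneLowerBoundEven.mono (by norm_num) (lOneLowerBoundEven_of_ciGapsEven hE hX))

/-- **The single-input reading** (proved, pure composition): granted the two verbatim ports, the even
shifted-convolution input with ANY tolerance plus Cor 6.3-even yields the twin, hence (with the printed odd
theorem) the leaf at 90 from one ζ-hypothesis. [cite: ConreyIwaniec2002, §§6–10] -/
theorem lOneLowerBound90_of_evenInput (hCI : conreyIwaniec2002_theorem12) {c₀ : ℕ}
    (h6 : CISixPortEven c₀) (h710 : CISevenTenPortEven c₀ 90)
    (hIn : ∃ b δ : ℝ, 0 < δ ∧ CIShiftedDivisor true b δ) (h63 : ∃ C : ℝ, CICor63EvenWith C)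
    (hX : ∃ c : ℝ, 0 < c ∧ SubnormalGapsHypothesis c) :
    Zhang2022.Skeleton.LOneLowerBound 90 :=
  lOneLowerBound90_of_ciGaps_twins hCI (h710 (h6 hIn h63) h63) hX

/-! ### 5. Sanity (proved): the tolerance bookkeeping `c(b,δ) = (b+6)/δ` at the printed values -/

/-- Printed tolerance `b = 6`, `δ = ¼` gives `c = 48 ≤ 65` (CI's cruder route via `Y ≤ T^{31/30}` prints 65);
either is invisible at the door's height `log T = (log q)^{20}`. [cite: ConreyIwaniec2002, (6.30)–(6.41), Proposition 6.4] -/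
example : ((6 : ℝ) + 6) / (1 / 4) = 48 ∧ (48 : ℝ) ≤ 65 := by norm_num

/-! ### 6. §R1 (answer-once to REF-F b2, precision P-F2-2): ONE CONDUCTOR SET PER ITEM.
The one station S4 + the two ports deliver the twin on SQUAREFREE conductors only (an even real primitive
`χ` mod squarefree `q` forces `q ≡ 1 (mod 4)`); the 2-adic conductors `4m, 8m` are a separately NAMED
supplement — the same scope gap the odd FACT carries as typed (S-2adic). All `Prop`s; never asserted. -/

/-- **`CITheorem12EvenSq`** — the even twin restricted to squarefree conductors: exactly the consequent the
ports can honestly claim from inputs typed with `Squarefree q`. [cite: ConreyIwaniec2002, Theorem 1.2 (shape, parity swapped, squarefree scope of §2/§7)] -/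
def CITheorem12EvenSq (A : ℕ) : Prop :=
  ∀ c : ℝ, 0 < c → ∃ c' : ℝ, 0 < c' ∧
    (SubnormalGapsHypothesis c →
      ∀ (q : ℕ) [NeZero q], 4 < q → Squarefree q → ∀ χ : DirichletCharacter ℂ q,
        χ.IsPrimitive → χ.IsQuadratic → χ.Even →
          c' * Real.log q ^ (-(A : ℝ)) ≤ ‖χ.LFunction 1‖)

/-- **`CITheorem12EvenTwoAdic`** — the 2-adic supplement (conductors `q = 4m, 8m`, i.e. `¬ Squarefree q`):
the residual the one-station port does NOT deliver (E4: the main-term density (4.32) itself changes there).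
[cite: ConreyIwaniec2002, §2 («q odd … without compromising our applications»), Theorem 1.2 (shape)] -/
def CITheorem12EvenTwoAdic (A : ℕ) : Prop :=
  ∀ c : ℝ, 0 < c → ∃ c' : ℝ, 0 < c' ∧
    (SubnormalGapsHypothesis c →
      ∀ (q : ℕ) [NeZero q], 4 < q → ¬ Squarefree q → ∀ χ : DirichletCharacter ℂ q,
        χ.IsPrimitive → χ.IsQuadratic → χ.Even →
          c' * Real.log q ^ (-(A : ℝ)) ≤ ‖χ.LFunction 1‖)

/-- **§§7–10 port, retyped on ONE conductor set** (antecedents and consequent all squarefree).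
[cite: ConreyIwaniec2002, §§7–10, Corollary 10.2] -/
def CISevenTenPortEvenSq (c₀ A : ℕ) : Prop :=
  CIProp64Even c₀ → (∃ C : ℝ, CICor63EvenWith C) → CITheorem12EvenSq A

/-- PROVED bookkeeping: the consumer-facing twin restricts to each conductor class. -/
theorem ciTheorem12EvenSq_of_even {A : ℕ} (h : CITheorem12Even A) : CITheorem12EvenSq A := by
  intro c hc
  obtain ⟨c', hc', H⟩ := h c hc
  exact ⟨c', hc', fun hS q _ hq _ χ hp hQ he => H hS q hq χ hp hQ he⟩

/-- PROVED bookkeeping: the two conductor classes reassemble the consumer-facing twin (constant `min c₁ c₂`). -/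
theorem ciTheorem12Even_of_sq_of_twoAdic {A : ℕ} (h₁ : CITheorem12EvenSq A) (h₂ : CITheorem12EvenTwoAdic A) :
    CITheorem12Even A := by
  intro c hc
  obtain ⟨c₁, hc₁, H₁⟩ := h₁ c hc
  obtain ⟨c₂, hc₂, H₂⟩ := h₂ c hc
  refine ⟨min c₁ c₂, lt_min hc₁ hc₂, ?_⟩
  intro hS q _ hq χ hprim hquad heven
  have hq1 : (1 : ℝ) ≤ (q : ℝ) := by exact_mod_cast (show 1 ≤ q by omega)
  have hL : 0 ≤ Real.log (q : ℝ) ^ (-(A : ℝ)) := Real.rpow_nonneg (Real.log_nonneg hq1) _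
  by_cases hsq : Squarefree q
  · exact le_trans (mul_le_mul_of_nonneg_right (min_le_left c₁ c₂) hL)
      (H₁ hS q hq hsq χ hprim hquad heven)
  · exact le_trans (mul_le_mul_of_nonneg_right (min_le_right c₁ c₂) hL)
      (H₂ hS q hq hsq χ hprim hquad heven)

/-- **The single-input reading with the conductor sets aligned** (proved, pure composition): the even
shifted-convolution input (any tolerance) + Cor 6.3-even, through the §6 port and the SQUAREFREE §§7–10
port, give the squarefree twin; the 2-adic supplement is the explicitly named extra hypothesis; with the
printed odd theorem the leaf shape at `90` follows from ONE ζ-hypothesis. [cite: ConreyIwaniec2002, §§6–10] -/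
theorem lOneLowerBound90_of_evenInputSq (hCI : conreyIwaniec2002_theorem12) {c₀ : ℕ}
    (h6 : CISixPortEven c₀) (h710 : CISevenTenPortEvenSq c₀ 90) (h2 : CITheorem12EvenTwoAdic 90)
    (hIn : ∃ b δ : ℝ, 0 < δ ∧ CIShiftedDivisor true b δ) (h63 : ∃ C : ℝ, CICor63EvenWith C)
    (hX : ∃ c : ℝ, 0 < c ∧ SubnormalGapsHypothesis c) :
    Zhang2022.Skeleton.LOneLowerBound 90 :=
  lOneLowerBound90_of_ciGaps_twins hCI
    (ciTheorem12Even_of_sq_of_twoAdic (h710 (h6 hIn h63) h63) h2) hX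

end Summit.Parity.GeneralizedHardyLittlewood.Theorems.PrimeLevelFamEdgeIdeaDeltas.EvenTwin

end
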